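import Summits.QuantumAdvantage.QuantumAdvantage.Theorems.WalkFiniteState
import Mathlib.NumberTheory.LegendreSymbol.AddCharacter
import Mathlib.NumberTheory.Cyclotomic.PrimitiveRoots
import Mathlib.Algebra.CharP.Two
import Mathlib.Algebra.CharP.Algebra
import Mathlib.Analysis.SpecificLimits.Normed
import HarnessLib

/-!
# Char-2 killing method, core (planner qa-qnc0-p2 g23, ROUND-23 §1) — part 1 of 2

The abstract machinery behind `Coset21.noPerfectLinSel` / `Coset21.linSel_loss_ge` (part 2, `WalkNoPerfectLinSel.lean`):

**Method (char-2 linearisation of the parity gate + a product "killing" functional).**  Work in a field `K` of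
characteristic `2` containing a primitive `p`-th root of unity `ω` and a primitive cube root `ζ` (`𝔽₂(μ_{3p})`).  Since
`(p : K) = 1` and `1 + ζ + ζ² = 0`:  `[L = r] = Σ_{a ∈ 𝔽_p} ω^{a(L−r)}` and `[T ≢ 0 (3)] = ζ^T + ζ^{2T}`, and the PARITY of the
live-and-firing tests is their SUM in `K`.  Hence, for tests `[Σ_i ℓ_{g,i} u_i = r_g]` and live conditions
`κ_g + Σ_i w_{g,i} u_i ≢ 0 (3)` (`w_{g,i} ∈ {1,2}`),
`#FIRE(u) = Σ_{g,a,b} ω^{−a r_g} ζ^{b κ_g} ∏_i (ω^{a ℓ_{g,i}} ζ^{b w_{g,i}})^{u_i}` in `K` (`b ∈ {1,2}`): a `2p·#G`-term combination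
of cube-restricted characters `χ_z(u) = ∏ z_i^{u_i}` (§3, `card_fire_eq_Wsum`).  The functional
`Φ_γ(f) = Σ_u f(u) ∏_{i : u_i = 0} γ_i` has `Φ_γ(χ_z) = ∏_i (z_i + γ_i)` and `Φ_γ(1) = ∏_i (1 + γ_i)` (§4).  A colouring
`γ_i = ω^{x_i} ζ^{y_i}` (`y_i ∈ {1,2}`) that HITS every term — each `(g,a,b)` has an `i` with `a ℓ_{g,i} = x_i`,
`b w_{g,i} ≡ y_i (3)` — kills every product (`z_i + γ_i = 2γ_i = 0`), while `∏ (1 + γ_i) ≠ 0` because `μ_3 ∩ μ_p = {1}` (§5).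
A hitting colouring exists by double counting when `#G·2p·(2p−1)^m < (2p)^m` (§6, `hits_exists`).

Nearest literature: exact-representation theory of `MOD_s ∘ MOD_p` circuits (Krause–Pudlák, TCS 174 (1997) Thm 5 — block restriction +
Smolensky degree in char `p`; Barrington–Straubing–Thérien 1990).  The killing functional replaces restriction and handles dense forms.
-/

open Finset

namespace Summit.QuantumAdvantage.AdviceFreeQNC0

namespace Coset21

namespace CharTwoKill

/-! ### §1 The walk exponent as a weighted sum -/

section Walk

variable {n : ℕ}

/-- walk weight of coordinate `i` seen from cut `g`: `2` if `i < g`, else `1`. -/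
def ww (g : ℕ) (i : Fin n) : ℕ := if i.val < g then 2 else 1

/-- the walk weights are `1` or `2` -/
theorem ww_mem (g : ℕ) (i : Fin n) : ww g i = 1 ∨ ww g i = 2 := by
  unfold ww; split_ifs <;> simp

/-- the walk exponent of cut `g` is the weighted form `Σ_i ww_{g,i} u_i` -/
theorem walkExp_eq_sum (u : Fin n → Bool) (g : ℕ) :
    walkExp u g = ∑ i, if u i = true then ww g i else 0 := by
  unfold walkExp wt wtPrefix ww
  rw [card_eq_sum_ones, card_eq_sum_ones, sum_filter, sum_filter, ← sum_add_distrib]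
  refine sum_congr rfl fun i _ => ?_
  by_cases h : u i = true <;> by_cases h' : i.val < g <;> simp [h, h']

end Walk

/-! ### §2 Field lemmas in characteristic two -/

section FieldLemmas

variable {K : Type*} [Field K]

/-- an additive character turns sums into products -/
theorem addChar_map_sum {A : Type*} [AddCommMonoid A] (ψ : AddChar A K) {ι : Type*} (s : Finset ι) (f : ι → A) :
    ψ (∑ i ∈ s, f i) = ∏ i ∈ s, ψ (f i) := by
  classical
  induction s using Finset.induction_on with
  | empty => simp [AddChar.map_zero_eq_one]
  | insert a s ha ih => rw [sum_insert ha, prod_insert ha, AddChar.map_add_eq_mul, ih]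

/-- `1 + ζ + ζ² = 0` for a primitive cube root of unity. -/
theorem one_add_add_sq_eq_zero {ζ : K} (hζ : IsPrimitiveRoot ζ 3) : 1 + ζ + ζ ^ 2 = 0 := by
  have h3 : ζ ^ 3 = 1 := hζ.pow_eq_one
  have h1 : ζ ≠ 1 := hζ.ne_one (by norm_num)
  have : (ζ - 1) * (1 + ζ + ζ ^ 2) = 0 := by ring_nf; rw [h3]; ring
  rcases mul_eq_zero.mp this with h | h
  · exact absurd (sub_eq_zero.mp h) h1
  · exact h

variable [CharP K 2]

/-- the live indicator `[T ≢ 0 (3)]` equals `ζ^T + ζ^{2T}` in characteristic two. -/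
theorem live_eq {ζ : K} (hζ : IsPrimitiveRoot ζ 3) (T : ℕ) :
    (if T % 3 ≠ 0 then (1 : K) else 0) = ζ ^ T + ζ ^ (2 * T) := by
  have h3 : ζ ^ 3 = 1 := hζ.pow_eq_one
  have hq := one_add_add_sq_eq_zero hζ
  have hsum : ζ + ζ ^ 2 = 1 := by
    have : ζ + ζ ^ 2 = -1 := by linear_combination hq
    rw [this, CharTwo.neg_eq]
  have hmod : ∀ m : ℕ, ζ ^ m = ζ ^ (m % 3) := fun m => by
    conv_lhs => rw [← Nat.mod_add_div m 3, pow_add, pow_mul, h3, one_pow, mul_one]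
  rw [hmod T, hmod (2 * T)]
  have hlt : T % 3 < 3 := Nat.mod_lt _ (by norm_num)
  interval_cases h : T % 3
  · have : 2 * T % 3 = 0 := by omega
    rw [this]; simp [CharTwo.add_self_eq_zero]
  · have : 2 * T % 3 = 2 := by omega
    rw [this]; simp [hsum]
  · have : 2 * T % 3 = 1 := by omega
    rw [this]; simp; rw [add_comm]; exact hsum.symm

variable {p : ℕ} [Fact p.Prime]

/-- `(p : K) = 1` for an odd prime in characteristic two -/
theorem natCast_p_eq_one (hp5 : 5 ≤ p) : (p : K) = 1 := by
  have hodd : p % 2 = 1 := by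
    by_contra hne
    have h2 : 2 ∣ p := Nat.dvd_of_mod_eq_zero (by omega)
    rcases (Fact.out : p.Prime).eq_one_or_self_of_dvd 2 h2 with h | h <;> omega
  rw [CharP.cast_eq_mod K 2 p, hodd, Nat.cast_one]

/-- orthogonality: `Σ_a ω^{a d} = [d = 0]` (times `p = 1`). -/
theorem indicator_eq_sum (hp5 : 5 ≤ p) {ω : K} (hω : IsPrimitiveRoot ω p) (d : ZMod p) :
    (if d = 0 then (1 : K) else 0) = ∑ a : ZMod p, AddChar.zmodChar p hω.pow_eq_one (a * d) := by
  classical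
  have hprim := AddChar.zmodChar_primitive_of_primitive_root p hω
  rw [AddChar.sum_mulShift d hprim, ZMod.card, Nat.cast_ite, Nat.cast_zero, natCast_p_eq_one hp5]

end FieldLemmas

/-! ### §3 The abstract game and the character expansion of its fire count

Cuts are indexed by a finite type `G`; cut `g` carries a linear form `ℓ g : Fin m → 𝔽_p`, a residue `r g`, a constant `κ g : ℕ`
and weights `w g : Fin m → ℕ` (values in `{1,2}`); it FIRES at `u` iff `Σ_i ℓ_{g,i} u_i = r_g` and `κ_g + Σ_i w_{g,i} u_i ≢ 0 (3)`. -/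

section Expansion

variable {p : ℕ} [Fact p.Prime] {K : Type*} [Field K] [CharP K 2]
variable {G : Type*} [Fintype G] {m : ℕ}
variable (ω ζ : K) (hω : IsPrimitiveRoot ω p)
variable (ℓ : G → Fin m → ZMod p) (r : G → ZMod p) (κ : G → ℕ) (w : G → Fin m → ℕ)

/-- the index set of terms `(g, a, b)`: cut, frequency, cube-root exponent `b+1 ∈ {1,2}` -/
abbrev Term (p : ℕ) (G : Type*) := G × ZMod p × Fin 2

/-- the additive character `a ↦ ω^{a}` of `ZMod p` -/
noncomputable def chi : AddChar (ZMod p) K := AddChar.zmodChar p hω.pow_eq_one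

/-- the linear form of cut `g` evaluated at `u` -/
def linForm (g : G) (u : Fin m → Bool) : ZMod p := ∑ i, if u i = true then ℓ g i else 0

/-- the weight form of cut `g` evaluated at `u` -/
def wForm (g : G) (u : Fin m → Bool) : ℕ := ∑ i, if u i = true then w g i else 0

/-- coordinate `i` of the character of term `t = (g,a,b)`: `ω^{a ℓ_{g,i}} ζ^{(b+1) w_{g,i}}` -/
noncomputable def zval (t : Term p G) (i : Fin m) : K :=
  chi ω hω (t.2.1 * ℓ t.1 i) * ζ ^ ((t.2.2.val + 1) * w t.1 i)

/-- the scalar coefficient of term `t = (g,a,b)`: `ω^{-a r_g} ζ^{(b+1) κ_g}` -/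
noncomputable def coef (t : Term p G) : K :=
  chi ω hω (-(t.2.1 * r t.1)) * ζ ^ ((t.2.2.val + 1) * κ t.1)

/-- the cube-restricted character `χ_z(u) = ∏_{i : u_i = 1} z_i` -/
def cubeChar (z : Fin m → K) (u : Fin m → Bool) : K := ∏ i, if u i = true then z i else 1

/-- the `K`-valued expansion `W(u) = Σ_t coef_t · χ_{z_t}(u)` -/
noncomputable def Wsum (u : Fin m → Bool) : K :=
  ∑ t : Term p G, coef ω ζ hω r κ t * cubeChar (zval ω ζ hω ℓ w t) u

omit [CharP K 2] [Fintype G] in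
/-- one term: `ω^{a(S−r)} ζ^{(b+1)T} = coef · χ_z(u)` -/
theorem term_eq (g : G) (a : ZMod p) (b : Fin 2) (u : Fin m → Bool) :
    chi ω hω (a * (linForm ℓ g u - r g)) * ζ ^ ((b.val + 1) * (κ g + wForm w g u))
      = coef ω ζ hω r κ (g, a, b) * cubeChar (zval ω ζ hω ℓ w (g, a, b)) u := by
  have h1 : chi ω hω (a * (linForm ℓ g u - r g))
      = chi ω hω (-(a * r g)) * ∏ i, (if u i = true then chi ω hω (a * ℓ g i) else 1) := by
    have : a * (linForm ℓ g u - r g) = -(a * r g) + ∑ i, (if u i = true then a * ℓ g i else 0) := by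
      unfold linForm
      rw [mul_sub, Finset.mul_sum]
      simp_rw [mul_ite, mul_zero]
      ring
    rw [this, AddChar.map_add_eq_mul, addChar_map_sum]
    congr 1
    refine prod_congr rfl fun i _ => ?_
    split_ifs <;> simp [AddChar.map_zero_eq_one]
  have h2 : ζ ^ ((b.val + 1) * (κ g + wForm w g u))
      = ζ ^ ((b.val + 1) * κ g) * ∏ i, (if u i = true then ζ ^ ((b.val + 1) * w g i) else 1) := by
    unfold wForm
    rw [mul_add, pow_add, Finset.mul_sum, ← prod_pow_eq_pow_sum]
    congr 1
    refine prod_congr rfl fun i _ => ?_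
    split_ifs <;> simp
  rw [h1, h2]
  unfold coef cubeChar zval
  rw [mul_mul_mul_comm, ← prod_mul_distrib]
  congr 1
  refine prod_congr rfl fun i _ => ?_
  split_ifs <;> simp

/-- **The expansion.** The number of firing cuts, cast into `K` (characteristic two!), equals `Wsum`. -/
theorem card_fire_eq_Wsum [DecidableEq G] (hp5 : 5 ≤ p) (hζ : IsPrimitiveRoot ζ 3) (u : Fin m → Bool) :
    (((univ.filter fun g : G => linForm ℓ g u = r g ∧ (κ g + wForm w g u) % 3 ≠ 0).card : ℕ) : K)
      = Wsum ω ζ hω ℓ r κ w u := by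
  classical
  rw [natCast_card_filter]
  unfold Wsum
  rw [Fintype.sum_prod_type]
  refine sum_congr rfl fun g _ => ?_
  rw [Fintype.sum_prod_type]
  have hind : (if (linForm ℓ g u = r g ∧ (κ g + wForm w g u) % 3 ≠ 0) then (1 : K) else 0)
      = (if linForm ℓ g u - r g = 0 then (1 : K) else 0) * (if (κ g + wForm w g u) % 3 ≠ 0 then (1 : K) else 0) := by
    rw [ite_zero_mul_ite_zero, one_mul]
    simp only [sub_eq_zero]
  rw [hind, indicator_eq_sum hp5 hω, live_eq hζ, Finset.sum_mul]
  refine sum_congr rfl fun a _ => ?_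
  rw [Fin.sum_univ_two, ← term_eq, ← term_eq, mul_add]
  congr 3; simp

end Expansion

/-! ### §4 The killing functional -/

section Functional

variable {K : Type*} [Field K] {m : ℕ}

/-- `Φ_γ(f) = Σ_u f(u) ∏_{i : u_i = 0} γ_i` -/
def Phi (γ : Fin m → K) (f : (Fin m → Bool) → K) : K := ∑ u, f u * ∏ i, (if u i = true then 1 else γ i)

/-- binomial expansion over the cube: `Σ_u ∏_i (u_i ? a_i : b_i) = ∏_i (a_i + b_i)` -/
theorem sum_prod_ite (z γ : Fin m → K) :
    ∑ u : Fin m → Bool, ∏ i, (if u i = true then z i else γ i) = ∏ i, (z i + γ i) := by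
  classical
  have := Finset.prod_univ_sum (fun _ : Fin m => (univ : Finset Bool)) (fun i b => if b = true then z i else γ i)
  rw [Fintype.piFinset_univ] at this
  rw [← this]
  refine prod_congr rfl fun i _ => ?_
  rw [Fintype.sum_bool]
  simp

/-- the killing functional on a (scaled) cube character is the product `C · ∏_i (z_i + γ_i)` -/
theorem Phi_cubeChar (γ z : Fin m → K) (C : K) :
    Phi γ (fun u => C * cubeChar z u) = C * ∏ i, (z i + γ i) := by
  unfold Phi cubeChar
  rw [← sum_prod_ite z γ, Finset.mul_sum]
  refine sum_congr rfl fun u _ => ?_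
  rw [mul_assoc, ← prod_mul_distrib]
  congr 1
  refine prod_congr rfl fun i _ => ?_
  split_ifs <;> simp

/-- the killing functional on the constant `1` -/
theorem Phi_one (γ : Fin m → K) : Phi γ (fun _ => (1 : K)) = ∏ i, (1 + γ i) := by
  unfold Phi
  rw [← sum_prod_ite (fun _ => 1) γ]
  refine sum_congr rfl fun u _ => ?_
  simp only [one_mul]

/-- the killing functional is additive -/
theorem Phi_sum {ι : Type*} (s : Finset ι) (γ : Fin m → K) (f : ι → (Fin m → Bool) → K) :
    Phi γ (fun u => ∑ t ∈ s, f t u) = ∑ t ∈ s, Phi γ (f t) := by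
  unfold Phi
  simp_rw [Finset.sum_mul]
  rw [Finset.sum_comm]

end Functional

/-! ### §5 Killing colourings: the character of a HIT term has a coordinate equal to `γ_i` -/

section Killing

variable {p : ℕ} [Fact p.Prime] {K : Type*} [Field K] [CharP K 2]
variable {G : Type*} [Fintype G] {m : ℕ}
variable (ω ζ : K) (hω : IsPrimitiveRoot ω p)
variable (ℓ : G → Fin m → ZMod p) (r : G → ZMod p) (κ : G → ℕ) (w : G → Fin m → ℕ)

/-- the colour of term `t = (g,a,b)` at coordinate `i`: `(a ℓ_{g,i}, (b+1) w_{g,i} mod 3) ∈ 𝔽_p × {1,2}` -/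
def colour (t : Term p G) (i : Fin m) : ZMod p × ℕ := (t.2.1 * ℓ t.1 i, ((t.2.2.val + 1) * w t.1 i) % 3)

/-- the field element `ω^x ζ^y` of a colour `(x, y)` -/
noncomputable def gam (x : ZMod p × ℕ) : K := chi ω hω x.1 * ζ ^ x.2

omit [Fintype G] in
/-- every colour lies in `𝔽_p × {1,2}` -/
theorem colour_mem (hw : ∀ g i, w g i = 1 ∨ w g i = 2) (t : Term p G) (i : Fin m) :
    colour ℓ w t i ∈ (univ : Finset (ZMod p)) ×ˢ ({1, 2} : Finset ℕ) := by
  rw [mem_product]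
  refine ⟨mem_univ _, ?_⟩
  simp only [colour, mem_insert, mem_singleton]
  have hb : t.2.2.val = 0 ∨ t.2.2.val = 1 := by have := t.2.2.isLt; omega
  rcases hw t.1 i with h | h <;> rcases hb with hb | hb <;> simp [h, hb]

/-- the number of terms is `#G · 2p` -/
theorem card_Term : Fintype.card (Term p G) = Fintype.card G * (2 * p) := by
  simp only [Term, Fintype.card_prod, ZMod.card, Fintype.card_fin]
  ring

omit [CharP K 2] [Fintype G] in
/-- the coordinates of a term character are `gam` of its colours -/
theorem zval_eq_gam (hζ : IsPrimitiveRoot ζ 3) (t : Term p G) (i : Fin m) :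
    zval ω ζ hω ℓ w t i = gam ω ζ hω (colour ℓ w t i) := by
  unfold zval gam colour
  simp only
  congr 1
  conv_lhs => rw [← Nat.mod_add_div ((t.2.2.val + 1) * w t.1 i) 3, pow_add, pow_mul, hζ.pow_eq_one,
    one_pow, mul_one]

/-- `Φ_γ(W) = 0` for a HITTING colouring (every term has a coordinate of matching colour): every term's product has a
factor `z_i + γ_i = 2 γ_i = 0`. -/
theorem Phi_Wsum_eq_zero (hζ : IsPrimitiveRoot ζ 3) (γ' : Fin m → ZMod p × ℕ)
    (hhit : ∀ t : Term p G, ∃ i, γ' i = colour ℓ w t i) :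
    Phi (fun i => gam ω ζ hω (γ' i)) (Wsum ω ζ hω ℓ r κ w) = 0 := by
  have hs : Phi (fun i => gam ω ζ hω (γ' i)) (Wsum ω ζ hω ℓ r κ w)
      = ∑ t : Term p G, Phi (fun i => gam ω ζ hω (γ' i))
          (fun u => coef ω ζ hω r κ t * cubeChar (zval ω ζ hω ℓ w t) u) :=
    Phi_sum univ _ _
  rw [hs]
  refine sum_eq_zero fun t _ => ?_
  rw [Phi_cubeChar]
  obtain ⟨i, hi⟩ := hhit t
  apply mul_eq_zero_of_right
  apply prod_eq_zero (mem_univ i)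
  rw [zval_eq_gam ω ζ hω ℓ w hζ t i, ← hi, CharTwo.add_self_eq_zero]

omit [Fintype G] in
/-- `1 + ω^x ζ^y ≠ 0` when `3 ∤ y` and `p ≠ 3`: otherwise `ζ^{yp} = 1`. -/
theorem one_add_gam_ne_zero (hp5 : 5 ≤ p) (hζ : IsPrimitiveRoot ζ 3) (x : ZMod p × ℕ) (hx : x.2 % 3 ≠ 0) :
    1 + gam ω ζ hω x ≠ 0 := by
  intro h
  rw [CharTwo.add_eq_zero] at h
  unfold gam at h
  have hpow : (chi ω hω x.1) ^ p = 1 := by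
    rw [← AddChar.map_nsmul_eq_pow, nsmul_eq_mul, ZMod.natCast_self, zero_mul, AddChar.map_zero_eq_one]
  have h3 : ζ ^ (x.2 * p) = 1 := by
    have := congrArg (fun z : K => z ^ p) h
    simp only [one_pow, mul_pow, hpow, one_mul, ← pow_mul] at this
    exact this.symm
  rw [hζ.pow_eq_one_iff_dvd] at h3
  rcases (Nat.Prime.dvd_mul Nat.prime_three).mp h3 with h3 | h3
  · obtain ⟨k, hk⟩ := h3
    omega
  · have := (Nat.prime_dvd_prime_iff_eq Nat.prime_three (Fact.out : p.Prime)).mp h3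
    omega

/-! ### §6 A hitting colouring exists (double counting) -/

omit [CharP K 2] in
/-- double counting: if `#terms·(|V|−1)^m < |V|^m` some colouring `γ' ∈ V^m` hits every term -/
theorem hits_exists (V : Finset (ZMod p × ℕ)) (hV : ∀ t i, colour ℓ w t i ∈ V)
    (hcount : Fintype.card (Term p G) * (V.card - 1) ^ m < V.card ^ m) :
    ∃ γ' : Fin m → ZMod p × ℕ, (∀ i, γ' i ∈ V) ∧ ∀ t : Term p G, ∃ i, γ' i = colour ℓ w t i := by
  classical
  by_contra hno
  push Not at hno
  set P := Fintype.piFinset (fun _ : Fin m => V) with hP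
  have hPcard : P.card = V.card ^ m := Fintype.card_piFinset_const V m
  have hmemP : ∀ γ' ∈ P, ∀ i, γ' i ∈ V := fun γ' h i => by
    rw [hP, Fintype.mem_piFinset] at h
    exact h i
  have key : P.card ≤ Fintype.card (Term p G) * (V.card - 1) ^ m := by
    calc P.card = ∑ γ' ∈ P, 1 := card_eq_sum_ones _
      _ ≤ ∑ γ' ∈ P, (univ.filter fun t : Term p G => ∀ i, γ' i ≠ colour ℓ w t i).card := by
          refine sum_le_sum fun γ' hγ' => ?_
          rw [Nat.one_le_iff_ne_zero, Ne, card_eq_zero, ← Ne, ← nonempty_iff_ne_empty]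
          obtain ⟨t, ht⟩ := hno γ' (hmemP γ' hγ')
          exact ⟨t, by simp [ht]⟩
      _ = ∑ γ' ∈ P, ∑ t : Term p G, (if (∀ i, γ' i ≠ colour ℓ w t i) then 1 else 0) := by
          simp_rw [card_filter]
      _ = ∑ t : Term p G, ∑ γ' ∈ P, (if (∀ i, γ' i ≠ colour ℓ w t i) then 1 else 0) := sum_comm
      _ = ∑ t : Term p G, (P.filter fun γ' => ∀ i, γ' i ≠ colour ℓ w t i).card := by
          simp_rw [card_filter]
      _ = ∑ t : Term p G, (V.card - 1) ^ m := by
          refine sum_congr rfl fun t _ => ?_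
          have hfe : P.filter (fun γ' => ∀ i, γ' i ≠ colour ℓ w t i)
              = Fintype.piFinset (fun i => V.erase (colour ℓ w t i)) := by
            ext γ'
            simp only [mem_filter, hP, Fintype.mem_piFinset, mem_erase]
            constructor
            · rintro ⟨h1, h2⟩ i; exact ⟨h2 i, h1 i⟩
            · intro h; exact ⟨fun i => (h i).2, fun i => (h i).1⟩
          rw [hfe, Fintype.card_piFinset]
          rw [prod_congr rfl fun i _ => card_erase_of_mem (hV t i)]
          simp
      _ = Fintype.card (Term p G) * (V.card - 1) ^ m := by rw [sum_const, smul_eq_mul, card_univ]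
  rw [hPcard] at key
  exact absurd hcount (not_lt.mpr key)

end Killing

end CharTwoKill

end Coset21

end Summit.QuantumAdvantage.AdviceFreeQNC0
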